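/-
Origin: expansion seat `planner-pub-hodgecm-pv10-0`, handover 2026-08-18 (`HOME/pub-hodgecm-pv10/lean/Pv10/PolarDecomposition.lean`, md5 70d302e1, 140 lines);
landed by the gen-6 packager in gate run 22 as `HodgeCM/PerL34/PolarDecomposition.lean` (import ^import Pv[0-9]+\.→import HodgeCM.PerL34. ×1).
-/
/-
Origin: planner-pub-hodgecm-pv10-0 (unit pub-hodgecm-pv10), HodgeCM publication cell, 2026-08-18.
Node N15 (PerL v5 §3.2, tex ll. 309–312): the hypothesis `hpolar` of the capstone
`N15Existence.exists_unitaryHeckeCharacter_of_isProperMap` ("every infinite idele class is an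
`L₀`-class times a norm-one class") reduced to its arithmetic core "the POSITIVE REAL ideles at infinity
come from `L₀`" — by the polar decomposition `z = |z| · z/|z|` in every `K_v`, KERNEL.
-/
import Summits.HodgeConjecture.HodgeCM.PerL34.NormOneTorus

/-!
# Polar decomposition of `K_∞^×` (node N15, hypothesis `hpolar`)

* `InfiniteAdeleRing.posRealUnits K`: the subgroup of `u ∈ K_∞^×` all of whose components are positive
  reals (under `extensionEmbedding v : K_v → ℂ`);
* `InfiniteAdeleRing.exists_posReal_mul_normOne`: every `u ∈ K_∞^×` is `p * t` with `p ∈ posRealUnits`,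
  `t ∈ normOneTorus` (`z = |z|·(z/|z|)` componentwise; `|z| ∈ K_v` because `extensionEmbedding v` is onto
  `ℝ` resp. `ℂ`);
* `NumberField.range_infUnitsToClass_le`: image(`K_∞^×`) ⊆ image(`posRealUnits`) ⊔ image(torus) in
  `C_K`, hence `NumberField.hpolar_of_posRealUnits_le`: if the positive-real classes lie in `f(A)` then
  `hpolar` holds for `f`.  For PerL (`A = C_{L₀}`, `L/L₀` CM) the remaining hypothesis is
  `ℝ_{>0} ⊂ L^×_{0,v} = ℝˣ` at every infinite place — an INPUT about the (untyped) map `C_{L₀} → C_L`.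
-/

set_option autoImplicit false

noncomputable section

open NumberField InfinitePlace NumberField.InfinitePlace.Completion

namespace NumberField

variable (K : Type*) [Field K]

namespace InfiniteAdeleRing

/-- Every real number is a value of `extensionEmbedding v` (onto `ℝ` at real `v`, onto `ℂ` at complex
`v`). -/
theorem exists_extensionEmbedding_eq_ofReal (v : InfinitePlace K) (r : ℝ) :
    ∃ x : v.Completion, extensionEmbedding v x = (r : ℂ) := by
  rcases isReal_or_isComplex v with hv | hv
  · obtain ⟨x, hx⟩ := surjective_extensionEmbeddingOfIsReal hv r
    exact ⟨x, by rw [← extensionEmbeddingOfIsReal_apply hv x, hx]⟩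
  · exact surjective_extensionEmbedding_of_isComplex hv (r : ℂ)

/-- (Ported verbatim from the HodgeCMPerL package; no docstring in the source.) -/
theorem norm_extensionEmbedding (v : InfinitePlace K) (x : v.Completion) :
    ‖extensionEmbedding v x‖ = ‖x‖ :=
  (isometry_extensionEmbedding v).norm_map_of_map_zero (map_zero _) x

/-- **Positive real ideles at infinity**: all components are positive reals. -/
def posRealUnits : Subgroup (InfiniteAdeleRing K)ˣ where
  carrier := {u | ∀ v : InfinitePlace K, ∃ r : ℝ, 0 < r ∧
    extensionEmbedding v ((u : InfiniteAdeleRing K) v) = (r : ℂ)}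
  mul_mem' {a b} ha hb v := by
    obtain ⟨r, hr, hra⟩ := ha v
    obtain ⟨s, hs, hsb⟩ := hb v
    refine ⟨r * s, mul_pos hr hs, ?_⟩
    have h : ((a * b : (InfiniteAdeleRing K)ˣ) : InfiniteAdeleRing K) v =
        (a : InfiniteAdeleRing K) v * (b : InfiniteAdeleRing K) v := rfl
    rw [h, map_mul, hra, hsb, Complex.ofReal_mul]
  one_mem' v := by
    refine ⟨1, one_pos, ?_⟩
    have h : ((1 : (InfiniteAdeleRing K)ˣ) : InfiniteAdeleRing K) v = 1 := rfl
    rw [h, map_one, Complex.ofReal_one]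
  inv_mem' {a} ha v := by
    obtain ⟨r, hr, hra⟩ := ha v
    refine ⟨r⁻¹, inv_pos.mpr hr, ?_⟩
    rw [inv_apply, map_inv₀, hra, Complex.ofReal_inv]

/-- (Ported verbatim from the HodgeCMPerL package; no docstring in the source.) -/
theorem mem_posRealUnits (u : (InfiniteAdeleRing K)ˣ) :
    u ∈ posRealUnits K ↔ ∀ v : InfinitePlace K, ∃ r : ℝ, 0 < r ∧
      extensionEmbedding v ((u : InfiniteAdeleRing K) v) = (r : ℂ) :=
  Iff.rfl

/-- **Polar decomposition `z = |z| · (z/|z|)`, componentwise.** -/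
theorem exists_posReal_mul_normOne (u : (InfiniteAdeleRing K)ˣ) :
    ∃ p ∈ posRealUnits K, ∃ t ∈ normOneTorus K, u = p * t := by
  classical
  -- the modulus idele `p` with `p_v ↦ ‖u_v‖`
  have hex : ∀ v : InfinitePlace K, ∃ x : v.Completion,
      extensionEmbedding v x = ((‖(u : InfiniteAdeleRing K) v‖ : ℝ) : ℂ) :=
    fun v => exists_extensionEmbedding_eq_ofReal K v _
  choose ρ hρ using hex
  have hρnorm : ∀ v, ‖ρ v‖ = ‖(u : InfiniteAdeleRing K) v‖ := by
    intro v
    rw [← norm_extensionEmbedding K v (ρ v), hρ v, Complex.norm_real, norm_norm]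
  have hρne : ∀ v, ρ v ≠ 0 := by
    intro v h
    have := hρnorm v
    rw [h, norm_zero] at this
    exact norm_ne_zero_iff.mpr (apply_ne_zero K u v) this.symm
  let p : (InfiniteAdeleRing K)ˣ :=
    ⟨fun v => ρ v, fun v => (ρ v)⁻¹, funext fun v => mul_inv_cancel₀ (hρne v),
      funext fun v => inv_mul_cancel₀ (hρne v)⟩
  have hp : ∀ v, (p : InfiniteAdeleRing K) v = ρ v := fun v => rfl
  refine ⟨p, fun v => ⟨‖(u : InfiniteAdeleRing K) v‖, norm_pos_iff.mpr (apply_ne_zero K u v), ?_⟩,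
    p⁻¹ * u, fun v => ?_, by rw [mul_inv_cancel_left]⟩
  · rw [hp, hρ v]
  · have h : ((p⁻¹ * u : (InfiniteAdeleRing K)ˣ) : InfiniteAdeleRing K) v =
        (↑p⁻¹ : InfiniteAdeleRing K) v * (u : InfiniteAdeleRing K) v := rfl
    rw [h, inv_apply, hp, norm_mul, norm_inv, hρnorm v,
      inv_mul_cancel₀ (norm_ne_zero_iff.mpr (apply_ne_zero K u v))]

/-- As subgroups: `K_∞^× = posRealUnits · normOneTorus`. -/
theorem posRealUnits_sup_normOneTorus : posRealUnits K ⊔ normOneTorus K = ⊤ := by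
  rw [eq_top_iff]
  intro u _
  obtain ⟨p, hp, t, ht, rfl⟩ := exists_posReal_mul_normOne K u
  exact Subgroup.mul_mem _ (Subgroup.mem_sup_left hp) (Subgroup.mem_sup_right ht)

end InfiniteAdeleRing

open InfiniteAdeleRing

variable [NumberField K]

/-- The positive-real idele classes. -/
def posRealToClass : posRealUnits K →* IdeleClassGroup K :=
  (infUnitsToClass K).comp (posRealUnits K).subtype

/-- (Ported verbatim from the HodgeCMPerL package; no docstring in the source.) -/
theorem posRealToClass_apply (p : posRealUnits K) :
    posRealToClass K p = infUnitsToClass K (p : (InfiniteAdeleRing K)ˣ) := rfl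

/-- **image(`K_∞^×`) ⊆ image(positive reals) ⊔ image(norm-one torus)** in `C_K`. -/
theorem range_infUnitsToClass_le :
    (infUnitsToClass K).range ≤ (posRealToClass K).range ⊔ (torusToClass K).range := by
  rintro _ ⟨u, rfl⟩
  obtain ⟨p, hp, t, ht, rfl⟩ := exists_posReal_mul_normOne K u
  rw [map_mul]
  exact Subgroup.mul_mem _ (Subgroup.mem_sup_left ⟨⟨p, hp⟩, rfl⟩)
    (Subgroup.mem_sup_right ⟨⟨t, ht⟩, rfl⟩)

/-- **`hpolar` from "positive reals come from `A`".**  If the positive-real idele classes lie in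
`f(A)` (PerL: `ℝ_{>0} ⊂ L^×_{0,v}` at every infinite place, `A = C_{L₀}`), then every infinite idele
class is an `f(A)`-class times a norm-one class. -/
theorem hpolar_of_posRealUnits_le {A : Type*} [Group A] (f : A →* IdeleClassGroup K)
    (hpos : (posRealToClass K).range ≤ f.range) :
    (infUnitsToClass K).range ≤ f.range ⊔ (torusToClass K).range :=
  (range_infUnitsToClass_le K).trans (sup_le_sup_right hpos _)

end NumberField
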